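import Summits.BirchSwinnertonDyer.BirchSwinnertonDyer.Theorems.KolyvaginDepthDoorMSymbolCertCosets
import Literature.NumberTheory.EllipticCurves.ModularCurveRealPeriodProofs
import Literature.NumberTheory.EllipticCurves.PAdicLFunctionDistributionHoldsProofs
import Literature.NumberTheory.EllipticCurves.ModularFormsGamma0Genus
import HarnessLib

/-!
# Route `KolyvaginDepthDoor`, crux `KolyvaginDepthSupplyKN` (stmt-BirchSwinnertonDyer-22820) —
# DEPTH TABLE v27, KIT 3/4: computable indices, MANIN-TRICK CHAINS for `{∞, a/n}`, and the PERIOD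
# NORMALISATION `re [q]_f = ± (Ω⁺_f / 2g) · φ(q)` ⟹ `[a/n]⁺_f = ± S(a/n) / 2g`

Helper file of the lead prover of line `levelone` (kdd-p1 g31; `--supports stmt-BirchSwinnertonDyer-22820
--as helper`); it closes nothing and BSD is NOT proved by it.

* `idxN N a c` — the index of the column `(a, c)` computed with `ℕ`-arithmetic only (inverse by Fermat,
  `a^(N-2)`), `idxN_eq_idxZ`; `actN`, `sN`, `uN`, `iotaN` — kernel-computable twins of `actIdx`, `sIdx`,
  `uIdx`, `iotaIdx` (`actN_eq` …).
* `chainIdx N fuel z w` — the indices of the M-symbols in Manin's continued-fraction expansion of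
  `{∞, k∞}` for `k = (x y; z w)`; `inftySymbol_eq_chain_sum` (the tree's `exists_chain` made explicit);
  `modularSymbol_eq_chain_sum` for `{∞, a/n}`; `chainSum φ …` (the kernel's integer `S(a/n) = ∑ φ`).
* `exists_plusPeriod_div` — if `re [q]_f = t · φ(q)` for all cosets with `φ` integral (`f` a rational
  newform), then `t = ± Ω⁺_f/(2g)` for a positive integer `g` (`re Λ_f = ℤ · Ω⁺_f/2`, every period is an
  integral chain of M-symbols).
* `ratPlusSymbol_eq_of_lineThrough` — then `[a/n]⁺_f = ± S(a/n)/(2g)` (`ratCast_ratPlusSymbol_holds`,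
  `plusSymbol = re {∞, r}` for real coefficients).

References: [CremonaAlgorithms1997] §2.2–2.3, §2.8; Manin 1972 Thm. 1.6; [MazurTateTeitelbaum1986Invent] §I.8.
-/

set_option linter.dupNamespace false

noncomputable section

open scoped MatrixGroups ModularForm
open CongruenceSubgroup Matrix.SpecialLinearGroup ModularGroup Matrix
open Literature.NumberTheory.EllipticCurves Literature.NumberTheory.EllipticCurves.ModularForms

namespace Summit.BirchSwinnertonDyer.BirchSwinnertonDyer.Theorems.KolyvaginDepthDoor.MSymbolCert

/-! ## §1 Kernel-computable indices -/

section Computable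

variable (N : ℕ)

/-- The index of the column `(a, c)` modulo the prime `N`, by `ℕ`-arithmetic: `N` if `N ∣ a`, else
`c · a^{N-2} mod N` (Fermat inverse). [cite: CremonaAlgorithms1997, §2.2] -/
def idxN (a c : ℤ) : ℕ :=
  if (a % N).toNat = 0 then N else ((c % N).toNat * (a % N).toNat ^ (N - 2)) % N

/-- The column of an index: `(1, i)` for `i < N`, `(0, 1)` otherwise. [folklore] -/
def colN (i : ℕ) : ℤ × ℤ := if i < N then (1, i) else (0, 1)

/-- Kernel-computable action of an integer matrix `(b₀₀ b₀₁; b₁₀ b₁₁)` (as a quadruple) on indices.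
[cite: PopaZagier2017, §5] -/
def actN (B : ℤ × ℤ × ℤ × ℤ) (i : ℕ) : ℕ :=
  idxN N (B.1 * (colN N i).1 + B.2.1 * (colN N i).2) (B.2.2.1 * (colN N i).1 + B.2.2.2 * (colN N i).2)

/-- Two-term partner index (`adj S = (0 1; -1 0)`). [folklore] -/
def sN (i : ℕ) : ℕ := actN N (0, 1, -1, 0) i

/-- Three-term partner index (`adj (TS) = (0 1; -1 1)`). [folklore] -/
def uN (i : ℕ) : ℕ := actN N (0, 1, -1, 1) i

/-- Conjugation partner index (`(a, c) ↦ (a, -c)`). [folklore] -/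
def iotaN (i : ℕ) : ℕ := idxN N (colN N i).1 (-(colN N i).2)

/-- The quadruple as a matrix. [folklore] -/
def toMat (B : ℤ × ℤ × ℤ × ℤ) : Matrix (Fin 2) (Fin 2) ℤ := !![B.1, B.2.1; B.2.2.1, B.2.2.2]

end Computable

section Prime

variable (N : ℕ) [hN : Fact N.Prime]

/-- `((a mod N).toNat : ZMod N) = a`. [folklore] -/
theorem natCast_toNat_emod (a : ℤ) : (((a % N).toNat : ℕ) : ZMod N) = (a : ZMod N) := by
  have h0 : 0 ≤ a % N := Int.emod_nonneg _ (by exact_mod_cast hN.out.ne_zero)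
  have : (((a % N).toNat : ℕ) : ℤ) = a % N := Int.toNat_of_nonneg h0
  rw [← Int.cast_natCast, this, ZMod.intCast_mod]

/-- `(a mod N).toNat = 0 ↔ (a : ZMod N) = 0`. [folklore] -/
theorem toNat_emod_eq_zero_iff (a : ℤ) : (a % N).toNat = 0 ↔ (a : ZMod N) = 0 := by
  have h0 : 0 ≤ a % N := Int.emod_nonneg _ (by exact_mod_cast hN.out.ne_zero)
  rw [← natCast_toNat_emod N a, ZMod.natCast_eq_zero_iff]
  constructor
  · intro h; rw [h]; exact dvd_zero _
  · intro h
    have hlt : (a % N).toNat < N := by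
      have := Int.emod_lt_of_pos a (show (0 : ℤ) < N by exact_mod_cast hN.out.pos)
      omega
    exact Nat.eq_zero_of_dvd_of_lt h hlt

/-- **`idxN = idxZ`**: the `ℕ`-computation is the index of `ModularSymbols` (Fermat: `a⁻¹ = a^{N-2}` in `ℤ/N`).
[folklore] -/
theorem idxN_eq_idxZ (a c : ℤ) : idxN N a c = idxZ N (a : ZMod N) (c : ZMod N) := by
  unfold idxN idxZ
  by_cases ha : (a : ZMod N) = 0
  · rw [if_pos ((toNat_emod_eq_zero_iff N a).mpr ha), if_pos ha]
  · rw [if_neg (fun h => ha ((toNat_emod_eq_zero_iff N a).mp h)), if_neg ha]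
    rw [← ZMod.val_natCast, Nat.cast_mul, Nat.cast_pow, natCast_toNat_emod, natCast_toNat_emod]
    congr 2
    -- `a^(N-2) = a⁻¹`
    have hF : (a : ZMod N) ^ (N - 1) = 1 := ZMod.pow_card_sub_one_eq_one ha
    have h2 : 2 ≤ N := hN.out.two_le
    have : (a : ZMod N) ^ (N - 2) * (a : ZMod N) = 1 := by
      rw [← pow_succ, show N - 2 + 1 = N - 1 by omega, hF]
    exact (eq_inv_of_mul_eq_one_left this)

/-- `colN` is `colZ`. [folklore] -/
theorem colZ_eq (i : ℕ) :
    colZ N i = ![((colN N i).1 : ZMod N), ((colN N i).2 : ZMod N)] := by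
  unfold colZ colN
  split_ifs <;> simp

/-- **`actN = actIdx`** on the matrix of the quadruple. [folklore] -/
theorem actN_eq (B : ℤ × ℤ × ℤ × ℤ) (i : ℕ) : actN N B i = actIdx N (toMat B) i := by
  rw [actN, actIdx, idxN_eq_idxZ, colZ_eq]
  congr 1 <;> simp [redMat, toMat, Matrix.mulVec, dotProduct, Fin.sum_univ_two]

/-- `sN = sIdx`. [folklore] -/
theorem sN_eq (i : ℕ) : sN N i = sIdx N i := by
  rw [sN, sIdx, actN_eq]; congr 1
  simp [toMat, ModularGroup.S, Matrix.adjugate_fin_two]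

/-- `uN = uIdx`. [folklore] -/
theorem uN_eq (i : ℕ) : uN N i = uIdx N i := by
  rw [uN, uIdx, actN_eq]; congr 1
  simp [toMat, ModularGroup.S, ModularGroup.T, Matrix.adjugate_fin_two]

/-- `iotaN = iotaIdx`. [folklore] -/
theorem iotaN_eq (i : ℕ) : iotaN N i = iotaIdx N i := by
  rw [iotaN, iotaIdx, idxN_eq_idxZ, colZ_eq]
  simp

/-! ## §2 Manin-trick chains -/

omit hN in
/-- The chain of indices of Manin's continued-fraction expansion of `{∞, k∞}`, driven by the bottom row
`(z, w)` of `k`: step `(z, w) ↦ (w mod z, -z)`, emitting the index of the column `(w mod z, -z)` (the first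
column of `(kTᵐ)⁻¹`, `m = -⌊w/z⌋`). [cite: CremonaAlgorithms1997, §2.3] -/
def chainIdx : ℕ → ℤ → ℤ → List ℕ
  | 0, _, _ => []
  | fuel + 1, z, w => if z = 0 then [] else idxN N (w % z) (-z) :: chainIdx fuel (w % z) (-z)

variable {N}
variable (f : CuspForm (Gamma0 N) 2)

/-- **Manin's trick, explicit**: `{∞, k∞}_f = ∑_{i ∈ chainIdx (z, w)} [e N i]_f` for `k = (x y; z w)`,
`|z| < fuel` (the tree's `exists_chain`, Euclid on the first column, with the chain written out).
[cite: CremonaAlgorithms1997, §2.3] -/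
theorem inftySymbol_eq_chain_sum : ∀ (fuel : ℕ) (k : SL(2, ℤ)), (k 1 0).natAbs < fuel →
    inftySymbol f k = ((chainIdx N fuel (k 1 0) (k 1 1)).map fun i => (msymbol N (e N i)) f).sum := by
  intro fuel
  induction fuel with
  | zero => intro k hk; exact absurd hk (Nat.not_lt_zero _)
  | succ fuel ih =>
    intro k hk
    by_cases hz : k 1 0 = 0
    · simp [chainIdx, hz, inftySymbol]
    · -- Euclidean step, as in `exists_chain`
      set m : ℤ := -(k 1 1 / k 1 0) with hm
      set k' : SL(2, ℤ) := k * T ^ m * S with hk'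
      have hk'10 : k' 1 0 = k 1 1 % k 1 0 := by
        simp only [hk', coe_mul, coe_S, coe_T_zpow, Matrix.mul_apply, Fin.sum_univ_two]
        simp [hm, Int.emod_def]
        ring
      have hk'11 : k' 1 1 = -(k 1 0) := by
        simp [hk', coe_mul, coe_S, coe_T_zpow, Matrix.mul_apply, Fin.sum_univ_two]
      have hlt : (k' 1 0).natAbs < fuel := by
        rw [hk'10]
        have h0 := Int.emod_nonneg (k 1 1) hz
        have h1 := Int.emod_lt_abs (k 1 1) hz
        zify at hk ⊢
        rw [abs_of_nonneg h0]
        omega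
      have hrec := ih k' hlt
      -- `{∞,k∞} = [kTᵐ] + {∞, k'∞}` and `[kTᵐ] = [e (idx of first column of (kTᵐ)⁻¹)]`
      have hsplit : inftySymbol f k = msymbolSL f (k * T ^ m) + inftySymbol f k' := by
        simp only [msymbolSL, hk', inftySymbol_mul_T_zpow]
        ring
      have hms : msymbolSL f (k * T ^ m) = (msymbol N (e N (idxN N (k 1 1 % k 1 0) (-(k 1 0))))) f := by
        have h00 : (((k * T ^ m)⁻¹ : SL(2, ℤ)) 0 0 : ℤ) = k 1 1 % k 1 0 := by
          rw [Int.emod_def]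
          simp [Matrix.SpecialLinearGroup.coe_inv, Matrix.adjugate_fin_two, coe_T_zpow, Matrix.mul_apply,
            Fin.sum_univ_two, hm]
          ring
        have h10 : (((k * T ^ m)⁻¹ : SL(2, ℤ)) 1 0 : ℤ) = -(k 1 0) := by
          simp [Matrix.SpecialLinearGroup.coe_inv, Matrix.adjugate_fin_two, coe_T_zpow, Matrix.mul_apply,
            Fin.sum_univ_two]
        rw [idxN_eq_idxZ, ← msymbolFunctional_apply,
          show msymbolFunctional (k * T ^ m) = msymbol N (((k * T ^ m)⁻¹ : SL(2, ℤ)) : Gamma0Coset N) by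
            rw [msymbol_mk, inv_inv], mk_eq_e, h00, h10]
      rw [hsplit, hrec, hk'10, hk'11, chainIdx, if_neg hz, List.map_cons, List.sum_cons, hms]

/-- The matrix `(a y; n w)` with `a w - y n = 1`. [folklore] -/
def bezoutSL (a y n w : ℤ) (h : a * w - y * n = 1) : SL(2, ℤ) :=
  ⟨!![a, y; n, w], by rw [Matrix.det_fin_two_of]; linarith⟩

/-- **`{∞, a/n}_f` as an explicit chain of M-symbols**: for `a w ≡ 1 (mod n)`, `0 < n < fuel`,
`{∞, a/n}_f = ∑_{i ∈ chainIdx fuel n w} [e N i]_f`. [cite: CremonaAlgorithms1997, §2.3] -/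
theorem modularSymbol_eq_chain_sum (a w : ℤ) (n : ℕ) (hn : 0 < n) (hw : a * w % n = 1) (fuel : ℕ)
    (hfuel : n < fuel) :
    modularSymbol f ((a : ℚ) / n) = ((chainIdx N fuel n w).map fun i => (msymbol N (e N i)) f).sum := by
  have hsplit := Int.emod_def (a * w) n
  rw [hw] at hsplit
  have hdet : a * w - (a * w / n) * n = 1 := by linarith
  set y : ℤ := a * w / n with hy
  have h := inftySymbol_eq_chain_sum f fuel (bezoutSL a y n w hdet) (by simpa [bezoutSL] using hfuel)
  have hn0 : (n : ℤ) ≠ 0 := by exact_mod_cast hn.ne'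
  simp only [bezoutSL, inftySymbol, Matrix.of_apply, Matrix.cons_val', Matrix.cons_val_zero,
    Matrix.cons_val_one, Matrix.cons_val_fin_one, hn0, ↓reduceIte] at h
  rw [← h]
  norm_cast

variable (N) in
/-- The kernel's chain value `S = ∑_{i ∈ chain} φ(i)`. [folklore] -/
def chainSum (φ : ℕ → ℤ) (fuel : ℕ) (z w : ℤ) : ℤ := ((chainIdx N fuel z w).map φ).sum

/-- Real parts along a chain on the line through `φ`: `re ∑ [e i]_f = t · chainSum φ`. [folklore] -/
theorem re_chain_sum_eq (φ : ℕ → ℤ) (t : ℝ) (hΨ : ∀ i, Ψ f i = t * φ i) (L : List ℕ) :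
    ((L.map fun i => (msymbol N (e N i)) f).sum).re = t * ((L.map φ).sum : ℤ) := by
  induction L with
  | nil => simp
  | cons i L ih =>
    simp only [List.map_cons, List.sum_cons, Complex.add_re, ih, Int.cast_add]
    rw [show ((msymbol N (e N i)) f).re = Ψ f i from rfl, hΨ i]
    ring

/-! ## §3 Period normalisation -/

/-- **Normalisation.** Let `f ∈ S₂(Γ₀(N))` be a normalised rational newform. If the real parts of ALL its
M-symbols lie on the line through an integer vector, `re [q]_f = t · φ(q)`, then `t = ± Ω⁺_f / (2g)` for some
integer `g ≥ 1`: every period `{∞, γ∞}_f` is an integral chain of M-symbols (`exists_chain`), so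
`re Λ_f ⊆ t ℤ`, while `re Λ_f = ℤ · Ω⁺_f / 2` (`plusPeriod`, `Ω⁺_f > 0`). [cite: CremonaAlgorithms1997, §2.8] -/
theorem exists_plusPeriod_div (hf : IsNewform0 f) (hQ : coeffField f = ⊥) {t : ℝ}
    {φ : Gamma0Coset N → ℤ} (hΨ : ∀ q, ((msymbol N q) f).re = t * φ q) :
    ∃ g : ℕ, 0 < g ∧ (t = plusPeriod f / (2 * g) ∨ t = -(plusPeriod f / (2 * g))) := by
  have hΩ : 0 < plusPeriod f := IsNewform0.plusPeriod_pos_holds hf hQ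
  have hre : realPeriods f = AddSubgroup.zmultiples (plusPeriod f / 2) :=
    realPeriods_eq_zmultiples_of_plusPeriod_pos f hΩ
  -- every period has real part in `t ℤ`
  have hlat : ∀ x ∈ periodLattice f, ∃ m : ℤ, x.re = t * m := by
    intro x hx
    induction hx using AddSubgroup.closure_induction with
    | mem x hx =>
      obtain ⟨γ, rfl⟩ := hx
      obtain ⟨c, hcint, hcm, -⟩ := exists_chain (N := N) (γ : SL(2, ℤ))
      have hval : cuspSymbol f γ = (msymbolMap N c) f := by
        rw [cuspSymbol_eq_inftySymbol, ← inftyFunctional_apply, ← hcm]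
      rw [hval, msymbolMap, Fintype.linearCombination_apply, LinearMap.sum_apply, Complex.re_sum]
      choose mq hmq using hcint
      refine ⟨∑ q, mq q * φ q, ?_⟩
      push_cast
      rw [Finset.mul_sum]
      refine Finset.sum_congr rfl fun q _ => ?_
      rw [LinearMap.smul_apply, Complex.smul_re, hΨ q, hmq q, Rat.smul_def]
      push_cast
      ring
    | zero => exact ⟨0, by simp⟩
    | add x y _ _ hx hy =>
      obtain ⟨a, ha⟩ := hx; obtain ⟨b, hb⟩ := hy
      exact ⟨a + b, by rw [Complex.add_re, ha, hb]; push_cast; ring⟩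
    | neg x _ hx =>
      obtain ⟨a, ha⟩ := hx
      exact ⟨-a, by rw [Complex.neg_re, ha]; push_cast; ring⟩
  -- `Ω/2 ∈ re Λ_f`
  have hmem : plusPeriod f / 2 ∈ realPeriods f := by rw [hre]; exact AddSubgroup.mem_zmultiples _
  rw [realPeriods, AddSubgroup.mem_map] at hmem
  obtain ⟨x, hx, hxre⟩ := hmem
  obtain ⟨m, hm⟩ := hlat x hx
  have hxre' : x.re = plusPeriod f / 2 := hxre
  rw [hxre'] at hm
  -- `Ω/2 = t m`, `m ≠ 0`
  have hm0 : m ≠ 0 := by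
    rintro rfl
    simp at hm
    linarith
  refine ⟨m.natAbs, Int.natAbs_pos.mpr hm0, ?_⟩
  rcases le_or_gt 0 m with hpos | hneg
  · left
    have : (m.natAbs : ℝ) = m := by rw [← Int.cast_natCast, Int.natAbs_of_nonneg hpos]
    rw [this]
    have hmR : (m : ℝ) ≠ 0 := by exact_mod_cast hm0
    field_simp
    linarith
  · right
    have : (m.natAbs : ℝ) = -m := by
      rw [← Int.cast_natCast, Int.ofNat_natAbs_of_nonpos hneg.le, Int.cast_neg]
    rw [this]
    have hmR : (m : ℝ) ≠ 0 := by exact_mod_cast hm0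
    field_simp
    linarith

/-- The index of a coset (so that `q = e N (cosetIdx q)`). [folklore] -/
def cosetIdx (q : Gamma0Coset N) : ℕ :=
  idxZ N ((Quotient.out q : SL(2, ℤ)) 0 0 : ℤ) ((Quotient.out q : SL(2, ℤ)) 1 0 : ℤ)

/-- Every coset is `e` of its index. [folklore] -/
theorem e_cosetIdx (q : Gamma0Coset N) : e N (cosetIdx q) = q := by
  rw [cosetIdx, ← mk_eq_e]
  exact QuotientGroup.out_eq' q

/-- `cosetIdx q ≤ N`. [folklore] -/
theorem cosetIdx_le (q : Gamma0Coset N) : cosetIdx q ≤ N := idxZ_le N _ _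

/-- **The value of `[a/n]⁺_f` on the line through `φ`.** If `re [e N i]_f = t φ(i)` for all `i ≤ N` (a
normalised rational newform `f`), then for `a w ≡ 1 (mod n)`, `0 < n < fuel`, there are `g ≥ 1` and
`ε = ±1`, the SAME for all `(a, n, w)`, with `[a/n]⁺_f = ε · S / (2g)`, `S = chainSum φ fuel n w`.
[cite: MazurTateTeitelbaum1986Invent, §I.8] -/
theorem exists_ratPlusSymbol_eq (hf : IsNewform0 f) (hQ : coeffField f = ⊥) {t : ℝ} {φ : ℕ → ℤ}
    (hΨ : ∀ i ≤ N, Ψ f i = t * φ i) :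
    ∃ (g : ℕ) (ε : ℤ), 0 < g ∧ (ε = 1 ∨ ε = -1) ∧
      ∀ (a w : ℤ) (n : ℕ), 0 < n → a * w % n = 1 → ∀ fuel : ℕ, n < fuel →
        ratPlusSymbol f ((a : ℚ) / n) = ε * chainSum N φ fuel n w / (2 * g) := by
  have hΨ' : ∀ i, Ψ f i = t * φ (min i N) := by
    intro i
    by_cases hi : i ≤ N
    · rw [min_eq_left hi]; exact hΨ i hi
    · have hi' : N < i := not_le.mp hi
      have : e N i = e N N := by unfold e; simp [hi'.le]
      rw [min_eq_right hi'.le, show Ψ f i = Ψ f N by simp [Ψ, this]]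
      exact hΨ N le_rfl
  have hall : ∀ q : Gamma0Coset N, ((msymbol N q) f).re = t * φ (min (cosetIdx q) N) := by
    intro q
    rw [← hΨ' (cosetIdx q), Ψ, e_cosetIdx]
  obtain ⟨g, hg, ht⟩ := exists_plusPeriod_div f hf hQ hall
  have hΩ : 0 < plusPeriod f := IsNewform0.plusPeriod_pos_holds hf hQ
  have hreal : ∀ m, (cuspCoeff f m).im = 0 := cuspCoeff_im_eq_zero_of_coeffField_eq_bot hQ
  set ε : ℤ := if t = plusPeriod f / (2 * g) then 1 else -1 with hε
  have hε1 : ε = 1 ∨ ε = -1 := by rw [hε]; split_ifs <;> simp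
  have htε : t = (ε : ℝ) * (plusPeriod f / (2 * g)) := by
    rw [hε]; split_ifs with h
    · simp [h]
    · rcases ht with h' | h'
      · exact absurd h' h
      · rw [h']; simp
  refine ⟨g, ε, hg, hε1, ?_⟩
  intro a w n hn hw fuel hfuel
  -- `[a/n]⁺ = re {∞, a/n} / Ω`
  have hsym : (ratPlusSymbol f ((a : ℚ) / n) : ℝ) = (modularSymbol f ((a : ℚ) / n)).re / plusPeriod f := by
    rw [ratCast_ratPlusSymbol_holds hf hQ, normalizedPlusSymbol,
      plusSymbol_eq_re_of f (modularSymbol_neg_eq_conj_holds f) hreal]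
    norm_cast
  have hchain := modularSymbol_eq_chain_sum f a w n hn hw fuel hfuel
  have hφ' : ∀ i, Ψ f i = t * (fun i => φ (min i N)) i := hΨ'
  have hre := re_chain_sum_eq f (fun i => φ (min i N)) t hφ' (chainIdx N fuel n w)
  -- the chain indices are `≤ N`, so `min` is harmless
  have hminL : ((chainIdx N fuel (n : ℤ) w).map fun i => φ (min i N)) = (chainIdx N fuel (n : ℤ) w).map φ := by
    apply List.map_congr_left
    intro i hi
    have : i ≤ N := by
      suffices h : ∀ fu z w', ∀ j ∈ chainIdx N fu z w', j ≤ N from h _ _ _ i hi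
      intro fu
      induction fu with
      | zero => intro z w' j hj; simp [chainIdx] at hj
      | succ fu ih =>
        intro z w' j hj
        simp only [chainIdx] at hj
        split_ifs at hj with hz0
        · simp at hj
        · rcases List.mem_cons.mp hj with rfl | hj
          · rw [idxN_eq_idxZ]; exact idxZ_le N _ _
          · exact ih _ _ j hj
    rw [min_eq_left this]
  rw [hminL] at hre
  have hΩ0 : plusPeriod f ≠ 0 := hΩ.ne'
  have hg0 : (g : ℝ) ≠ 0 := by exact_mod_cast hg.ne'
  have key : (ratPlusSymbol f ((a : ℚ) / n) : ℝ) = (ε : ℝ) * (chainSum N φ fuel n w : ℝ) / (2 * g) := by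
    rw [hsym, hchain, hre, htε, chainSum]
    field_simp
  have : ((ratPlusSymbol f ((a : ℚ) / n) : ℚ) : ℝ) = ((ε * chainSum N φ fuel n w / (2 * g) : ℚ) : ℝ) := by
    rw [key]; push_cast; ring
  exact_mod_cast this

end Prime

end Summit.BirchSwinnertonDyer.BirchSwinnertonDyer.Theorems.KolyvaginDepthDoor.MSymbolCert

end
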